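import Mathlib
import HarnessLib

/-!
# Route `KLProgramme` — engine support, route (L2), FAT layer, WEIGHTED: scalar inequalities for the closed form of `α_w` — the ORDER-THREE
# Leibniz left-hand sides of `slicePairWt_bgmFat_le` are `O(step³/Λ³)` (time, axes, normal, tangent at the isotropic rate), with explicit constants

Cell `gate-hubbard-kl`, seat p3 (g10); program «W3α = α_w rows instance» (KL STATUS 2026-08-27 20:43Z), file (α2a) — the order-three companion
of k3c2-p3's `…AlphaFatScalars` (`timeLeibniz_eq`, `spaceLeibniz_le`, `tangentLeibniz_le`).  Conventions as there: `Λ_m = 4Λ` (fat radial scale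
one above the slice), steps `t ≤ 1` with Euclidean norm `√2·t`, `Λ ≤ e₀`.

* `timeLeibniz3_eq` — the order-three time quantity is `A₀·(π/β)³·D_t3/Λ³`, `D_t3 = 2C₃ + 3G₁C₂ + (3/8)(4G₂+2G₁)C₁ + (8G₃+12G₂)/8`, `A₀ = c₀·4c/Λ`;
* `spaceLeibniz3_le` — if `a₁ ≤ t·ā₁/Λ`, `a₂ ≤ t²·ā₂/Λ²`, `a₃ ≤ t³·ā₃/Λ³` then the order-three space quantity (tangency slot `K₁·√2t`) is
  `≤ A₀·t³·q₃/Λ³` with `q₃` explicit;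
* `tangentLeibniz3_le` — the same with the tangency slot `τ_t ≤ t·b_τ`;
* `tauT_le_step` — `τ_t = ℓ₁(4+2A) + K₂(√2ρ_f)(√2ℓ) ≤ ℓ·((4+2A) + 2K₂c_ρπ)` for `ℓ₁ ≤ ℓ`, `ρ_f ≤ c_ρπ`.

Pure real algebra; no definitions. [folklore]
-/

noncomputable section

namespace Summit.HubbardSuperconductivity.HubbardSuperconductivity.Theorems.TorusFourierL2

set_option linter.dupNamespace false -- summit = problem name (single-conjunct summit), D-0017

/-! ### §1 Time: exact closed form at order three -/

/-- **Order-three time quantity, closed form** (`Λ_m = 4Λ`): `= A₀·((π/β)³·D_t3/Λ³)`,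
`D_t3 = 2C₃ + 3G₁C₂ + (3/8)(4G₂+2G₁)C₁ + (8G₃+12G₂)/8`. [folklore] -/
theorem timeLeibniz3_eq {c₀ c C₁ C₂ C₃ G₁ G₂ G₃ β Λ Λm : ℝ} (hβ : 0 < β) (hΛ : 0 < Λ) (hΛm : Λm = 4 * Λ) :
    c₀ * (1 * ((2 * Real.pi / β) ^ 3 * (C₃ * c / Λ ^ 4)) +
        3 * ((2 * G₁ * |2 * Real.pi / β| * 1 / Λm) * ((2 * Real.pi / β) ^ 2 * (C₂ * c / Λ ^ 3))) +
        3 * (((4 * G₂ + 2 * G₁) * (2 * Real.pi / β) ^ 2 * 1 / Λm ^ 2) * ((2 * Real.pi / β) * (C₁ * c / Λ ^ 2))) +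
        ((8 * G₃ + 12 * G₂) * |2 * Real.pi / β| ^ 3 * 1 / Λm ^ 3) * (4 * c / Λ)) =
      c₀ * (4 * c / Λ) * ((Real.pi / β) ^ 3 * (2 * C₃ + 3 * G₁ * C₂ + 3 / 8 * (4 * G₂ + 2 * G₁) * C₁ + (8 * G₃ + 12 * G₂) / 8) / Λ ^ 3) := by
  rw [abs_of_pos (by positivity : (0 : ℝ) < 2 * Real.pi / β), hΛm]
  field_simp
  ring

/-! ### §2 Space directions with the tangency slot `K₁·√2t` (axes `t = ℓ₁`, normal `t = ℓ`) -/

set_option maxHeartbeats 800000 in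
/-- **The order-three Leibniz quantity of a space direction with trivial tangency**: if `a₁ ≤ t·ā₁/Λ`, `a₂ ≤ t²·ā₂/Λ²`, `a₃ ≤ t³·ā₃/Λ³`,
`0 ≤ t ≤ 1`, `0 < Λ ≤ e₀`, then
`Q₃ ≤ A₀·t³·q₃/Λ³`, `q₃ = C₃(√2K₁+12K₂)³/4 + (3/2)C₂K₂(√2K₁+12K₂)e₀ + (√2/2)C₁K₃e₀² + 3ā₁(C₂(√2K₁+10K₂)²/4 + C₁K₂e₀/2) + (3/4)ā₂C₁(√2K₁+8K₂) + ā₃`,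
`A₀ = c₀·4c/Λ`. [folklore] -/
theorem spaceLeibniz3_le {c₀ c C₁ C₂ C₃ K₁ K₂ K₃ Λ e₀ t a₁ a₂ a₃ ab₁ ab₂ ab₃ : ℝ} (hc₀ : 0 ≤ c₀) (hc : 0 ≤ c) (hC₁ : 0 ≤ C₁) (hC₂ : 0 ≤ C₂)
    (hC₃ : 0 ≤ C₃) (hK₁ : 0 ≤ K₁) (hK₂ : 0 ≤ K₂) (hK₃ : 0 ≤ K₃) (hΛ : 0 < Λ) (hΛe : Λ ≤ e₀) (ht0 : 0 ≤ t) (ht1 : t ≤ 1)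
    (hab₁ : 0 ≤ ab₁) (hab₂ : 0 ≤ ab₂) (ha₁ : a₁ ≤ t * ab₁ / Λ) (ha₂ : a₂ ≤ t ^ 2 * ab₂ / Λ ^ 2) (ha₃ : a₃ ≤ t ^ 3 * ab₃ / Λ ^ 3) :
    c₀ * (1 * (C₃ * c / Λ ^ 4 * (K₁ * (Real.sqrt 2 * t) + 6 * (K₂ * (Real.sqrt 2 * t) ^ 2)) ^ 3 +
          3 * (C₂ * c / Λ ^ 3 * (K₁ * (Real.sqrt 2 * t) + 6 * (K₂ * (Real.sqrt 2 * t) ^ 2)) * (K₂ * (Real.sqrt 2 * t) ^ 2)) +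
          C₁ * c / Λ ^ 2 * (K₃ * (Real.sqrt 2 * t) ^ 3)) +
        3 * (a₁ * (C₂ * c / Λ ^ 3 * (K₁ * (Real.sqrt 2 * t) + 5 * (K₂ * (Real.sqrt 2 * t) ^ 2)) ^ 2 + C₁ * c / Λ ^ 2 * (K₂ * (Real.sqrt 2 * t) ^ 2))) +
        3 * (a₂ * (C₁ * c / Λ ^ 2 * (K₁ * (Real.sqrt 2 * t) + 4 * (K₂ * (Real.sqrt 2 * t) ^ 2)))) + a₃ * (4 * c / Λ)) ≤
      c₀ * (4 * c / Λ) * (t ^ 3 * (C₃ * (Real.sqrt 2 * K₁ + 12 * K₂) ^ 3 / 4 + 3 / 2 * C₂ * K₂ * (Real.sqrt 2 * K₁ + 12 * K₂) * e₀ +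
        Real.sqrt 2 / 2 * C₁ * K₃ * e₀ ^ 2 + 3 * ab₁ * (C₂ * (Real.sqrt 2 * K₁ + 10 * K₂) ^ 2 / 4 + C₁ * K₂ * e₀ / 2) +
        3 / 4 * ab₂ * C₁ * (Real.sqrt 2 * K₁ + 8 * K₂) + ab₃) / Λ ^ 3) := by
  have hs2 : Real.sqrt 2 ^ 2 = 2 := Real.sq_sqrt (by norm_num)
  have hs3 : Real.sqrt 2 ^ 3 = 2 * Real.sqrt 2 := by rw [pow_succ, hs2]
  have hs0 : 0 ≤ Real.sqrt 2 := Real.sqrt_nonneg 2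
  have he₀ : 0 < e₀ := lt_of_lt_of_le hΛ hΛe
  have ht2 : t ^ 2 ≤ t := by nlinarith
  have hst : (Real.sqrt 2 * t) ^ 2 = 2 * t ^ 2 := by rw [mul_pow, hs2]
  have hst3 : (Real.sqrt 2 * t) ^ 3 = 2 * Real.sqrt 2 * t ^ 3 := by rw [mul_pow, hs3]
  -- the inner quantities are `≤ t·(…)`
  have hX : ∀ k : ℝ, 0 ≤ k → K₁ * (Real.sqrt 2 * t) + k * (K₂ * (Real.sqrt 2 * t) ^ 2) ≤ t * (Real.sqrt 2 * K₁ + 2 * k * K₂) := by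
    intro k hk
    rw [hst]
    have e : t * (Real.sqrt 2 * K₁ + 2 * k * K₂) = K₁ * (Real.sqrt 2 * t) + 2 * k * (K₂ * t) := by ring
    rw [e]
    have := mul_le_mul_of_nonneg_left ht2 (by positivity : 0 ≤ 2 * k * K₂)
    nlinarith [this]
  have hX0 : ∀ k : ℝ, 0 ≤ k → 0 ≤ K₁ * (Real.sqrt 2 * t) + k * (K₂ * (Real.sqrt 2 * t) ^ 2) := fun k hk => by positivity
  have h6 := hX 6 (by norm_num); have h60 := hX0 6 (by norm_num)
  have h5 := hX 5 (by norm_num); have h50 := hX0 5 (by norm_num)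
  have h4 := hX 4 (by norm_num); have h40 := hX0 4 (by norm_num)
  have hY : K₂ * (Real.sqrt 2 * t) ^ 2 = 2 * K₂ * t ^ 2 := by rw [hst]; ring
  have hΛ2 := pow_pos hΛ 2; have hΛ3 := pow_pos hΛ 3; have hΛ4 := pow_pos hΛ 4
  -- term A
  have TA : C₃ * c / Λ ^ 4 * (K₁ * (Real.sqrt 2 * t) + 6 * (K₂ * (Real.sqrt 2 * t) ^ 2)) ^ 3 ≤
      (4 * c / Λ) * (t ^ 3 / Λ ^ 3) * (C₃ * (Real.sqrt 2 * K₁ + 12 * K₂) ^ 3 / 4) := by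
    have h := pow_le_pow_left₀ h60 h6 3
    have e6 : (2 : ℝ) * 6 = 12 := by norm_num
    rw [e6] at h
    calc C₃ * c / Λ ^ 4 * (K₁ * (Real.sqrt 2 * t) + 6 * (K₂ * (Real.sqrt 2 * t) ^ 2)) ^ 3
        ≤ C₃ * c / Λ ^ 4 * (t * (Real.sqrt 2 * K₁ + 12 * K₂)) ^ 3 := mul_le_mul_of_nonneg_left h (by positivity)
      _ = (4 * c / Λ) * (t ^ 3 / Λ ^ 3) * (C₃ * (Real.sqrt 2 * K₁ + 12 * K₂) ^ 3 / 4) := by field_simp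
  -- term B
  have TB : 3 * (C₂ * c / Λ ^ 3 * (K₁ * (Real.sqrt 2 * t) + 6 * (K₂ * (Real.sqrt 2 * t) ^ 2)) * (K₂ * (Real.sqrt 2 * t) ^ 2)) ≤
      (4 * c / Λ) * (t ^ 3 / Λ ^ 3) * (3 / 2 * C₂ * K₂ * (Real.sqrt 2 * K₁ + 12 * K₂) * e₀) := by
    have e6 : (2 : ℝ) * 6 = 12 := by norm_num
    rw [e6] at h6
    calc 3 * (C₂ * c / Λ ^ 3 * (K₁ * (Real.sqrt 2 * t) + 6 * (K₂ * (Real.sqrt 2 * t) ^ 2)) * (K₂ * (Real.sqrt 2 * t) ^ 2))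
        ≤ 3 * (C₂ * c / Λ ^ 3 * (t * (Real.sqrt 2 * K₁ + 12 * K₂)) * (K₂ * (Real.sqrt 2 * t) ^ 2)) := by
          have := mul_le_mul_of_nonneg_left h6 (by positivity : 0 ≤ C₂ * c / Λ ^ 3)
          have := mul_le_mul_of_nonneg_right this (by positivity : 0 ≤ K₂ * (Real.sqrt 2 * t) ^ 2)
          linarith
      _ = (4 * c / Λ) * (t ^ 3 / Λ ^ 3) * (3 / 2 * C₂ * K₂ * (Real.sqrt 2 * K₁ + 12 * K₂) * Λ) := by rw [hY]; field_simp; ring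
      _ ≤ (4 * c / Λ) * (t ^ 3 / Λ ^ 3) * (3 / 2 * C₂ * K₂ * (Real.sqrt 2 * K₁ + 12 * K₂) * e₀) := by gcongr
  -- term C
  have TC : C₁ * c / Λ ^ 2 * (K₃ * (Real.sqrt 2 * t) ^ 3) ≤ (4 * c / Λ) * (t ^ 3 / Λ ^ 3) * (Real.sqrt 2 / 2 * C₁ * K₃ * e₀ ^ 2) := by
    rw [hst3]
    have hΛe2 : Λ ^ 2 ≤ e₀ ^ 2 := pow_le_pow_left₀ hΛ.le hΛe 2
    calc C₁ * c / Λ ^ 2 * (K₃ * (2 * Real.sqrt 2 * t ^ 3)) = (4 * c / Λ) * (t ^ 3 / Λ ^ 3) * (Real.sqrt 2 / 2 * C₁ * K₃ * Λ ^ 2) := by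
          field_simp; ring
      _ ≤ (4 * c / Λ) * (t ^ 3 / Λ ^ 3) * (Real.sqrt 2 / 2 * C₁ * K₃ * e₀ ^ 2) := by gcongr
  -- term D
  have TD : 3 * (a₁ * (C₂ * c / Λ ^ 3 * (K₁ * (Real.sqrt 2 * t) + 5 * (K₂ * (Real.sqrt 2 * t) ^ 2)) ^ 2 + C₁ * c / Λ ^ 2 * (K₂ * (Real.sqrt 2 * t) ^ 2))) ≤
      (4 * c / Λ) * (t ^ 3 / Λ ^ 3) * (3 * ab₁ * (C₂ * (Real.sqrt 2 * K₁ + 10 * K₂) ^ 2 / 4 + C₁ * K₂ * e₀ / 2)) := by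
    have e5 : (2 : ℝ) * 5 = 10 := by norm_num
    rw [e5] at h5
    have hbr0 : 0 ≤ C₂ * c / Λ ^ 3 * (K₁ * (Real.sqrt 2 * t) + 5 * (K₂ * (Real.sqrt 2 * t) ^ 2)) ^ 2 + C₁ * c / Λ ^ 2 * (K₂ * (Real.sqrt 2 * t) ^ 2) := by
      positivity
    have hbr : C₂ * c / Λ ^ 3 * (K₁ * (Real.sqrt 2 * t) + 5 * (K₂ * (Real.sqrt 2 * t) ^ 2)) ^ 2 + C₁ * c / Λ ^ 2 * (K₂ * (Real.sqrt 2 * t) ^ 2) ≤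
        t ^ 2 * (C₂ * c * (Real.sqrt 2 * K₁ + 10 * K₂) ^ 2 / Λ ^ 3 + 2 * C₁ * c * K₂ / Λ ^ 2) := by
      have hsq := pow_le_pow_left₀ h50 h5 2
      have t1 := mul_le_mul_of_nonneg_left hsq (by positivity : 0 ≤ C₂ * c / Λ ^ 3)
      have e : t ^ 2 * (C₂ * c * (Real.sqrt 2 * K₁ + 10 * K₂) ^ 2 / Λ ^ 3 + 2 * C₁ * c * K₂ / Λ ^ 2) =
          C₂ * c / Λ ^ 3 * (t * (Real.sqrt 2 * K₁ + 10 * K₂)) ^ 2 + C₁ * c / Λ ^ 2 * (K₂ * (Real.sqrt 2 * t) ^ 2) := by rw [hY]; ring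
      rw [e]; linarith
    calc 3 * (a₁ * (C₂ * c / Λ ^ 3 * (K₁ * (Real.sqrt 2 * t) + 5 * (K₂ * (Real.sqrt 2 * t) ^ 2)) ^ 2 + C₁ * c / Λ ^ 2 * (K₂ * (Real.sqrt 2 * t) ^ 2)))
        ≤ 3 * ((t * ab₁ / Λ) * (t ^ 2 * (C₂ * c * (Real.sqrt 2 * K₁ + 10 * K₂) ^ 2 / Λ ^ 3 + 2 * C₁ * c * K₂ / Λ ^ 2))) := by
          have := mul_le_mul ha₁ hbr hbr0 (by positivity)
          linarith
      _ = (4 * c / Λ) * (t ^ 3 / Λ ^ 3) * (3 * ab₁ * (C₂ * (Real.sqrt 2 * K₁ + 10 * K₂) ^ 2 / 4 + C₁ * K₂ * Λ / 2)) := by field_simp; ring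
      _ ≤ (4 * c / Λ) * (t ^ 3 / Λ ^ 3) * (3 * ab₁ * (C₂ * (Real.sqrt 2 * K₁ + 10 * K₂) ^ 2 / 4 + C₁ * K₂ * e₀ / 2)) := by gcongr
  -- term E
  have TE : 3 * (a₂ * (C₁ * c / Λ ^ 2 * (K₁ * (Real.sqrt 2 * t) + 4 * (K₂ * (Real.sqrt 2 * t) ^ 2)))) ≤
      (4 * c / Λ) * (t ^ 3 / Λ ^ 3) * (3 / 4 * ab₂ * C₁ * (Real.sqrt 2 * K₁ + 8 * K₂)) := by
    have e4 : (2 : ℝ) * 4 = 8 := by norm_num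
    rw [e4] at h4
    have hbr0 : 0 ≤ C₁ * c / Λ ^ 2 * (K₁ * (Real.sqrt 2 * t) + 4 * (K₂ * (Real.sqrt 2 * t) ^ 2)) := by positivity
    have hbr : C₁ * c / Λ ^ 2 * (K₁ * (Real.sqrt 2 * t) + 4 * (K₂ * (Real.sqrt 2 * t) ^ 2)) ≤ C₁ * c / Λ ^ 2 * (t * (Real.sqrt 2 * K₁ + 8 * K₂)) :=
      mul_le_mul_of_nonneg_left h4 (by positivity)
    calc 3 * (a₂ * (C₁ * c / Λ ^ 2 * (K₁ * (Real.sqrt 2 * t) + 4 * (K₂ * (Real.sqrt 2 * t) ^ 2))))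
        ≤ 3 * ((t ^ 2 * ab₂ / Λ ^ 2) * (C₁ * c / Λ ^ 2 * (t * (Real.sqrt 2 * K₁ + 8 * K₂)))) := by
          have := mul_le_mul ha₂ hbr hbr0 (by positivity)
          linarith
      _ = (4 * c / Λ) * (t ^ 3 / Λ ^ 3) * (3 / 4 * ab₂ * C₁ * (Real.sqrt 2 * K₁ + 8 * K₂)) := by field_simp
  -- term F
  have TF : a₃ * (4 * c / Λ) ≤ (4 * c / Λ) * (t ^ 3 / Λ ^ 3) * ab₃ := by
    calc a₃ * (4 * c / Λ) ≤ (t ^ 3 * ab₃ / Λ ^ 3) * (4 * c / Λ) := mul_le_mul_of_nonneg_right ha₃ (by positivity)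
      _ = (4 * c / Λ) * (t ^ 3 / Λ ^ 3) * ab₃ := by field_simp
  have e : c₀ * (4 * c / Λ) * (t ^ 3 * (C₃ * (Real.sqrt 2 * K₁ + 12 * K₂) ^ 3 / 4 + 3 / 2 * C₂ * K₂ * (Real.sqrt 2 * K₁ + 12 * K₂) * e₀ +
        Real.sqrt 2 / 2 * C₁ * K₃ * e₀ ^ 2 + 3 * ab₁ * (C₂ * (Real.sqrt 2 * K₁ + 10 * K₂) ^ 2 / 4 + C₁ * K₂ * e₀ / 2) +
        3 / 4 * ab₂ * C₁ * (Real.sqrt 2 * K₁ + 8 * K₂) + ab₃) / Λ ^ 3) =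
      c₀ * ((4 * c / Λ) * (t ^ 3 / Λ ^ 3) * (C₃ * (Real.sqrt 2 * K₁ + 12 * K₂) ^ 3 / 4) +
        (4 * c / Λ) * (t ^ 3 / Λ ^ 3) * (3 / 2 * C₂ * K₂ * (Real.sqrt 2 * K₁ + 12 * K₂) * e₀) +
        (4 * c / Λ) * (t ^ 3 / Λ ^ 3) * (Real.sqrt 2 / 2 * C₁ * K₃ * e₀ ^ 2) +
        (4 * c / Λ) * (t ^ 3 / Λ ^ 3) * (3 * ab₁ * (C₂ * (Real.sqrt 2 * K₁ + 10 * K₂) ^ 2 / 4 + C₁ * K₂ * e₀ / 2)) +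
        (4 * c / Λ) * (t ^ 3 / Λ ^ 3) * (3 / 4 * ab₂ * C₁ * (Real.sqrt 2 * K₁ + 8 * K₂)) +
        (4 * c / Λ) * (t ^ 3 / Λ ^ 3) * ab₃) := by ring
  rw [e]
  refine mul_le_mul_of_nonneg_left ?_ hc₀
  linarith [TA, TB, TC, TD, TE, TF]

/-! ### §3 The tangent direction at the ISOTROPIC rate (order three): tangency slot `τ_t ≤ t·b_τ` -/

set_option maxHeartbeats 800000 in
/-- **The order-three Leibniz quantity of the tangent direction at the isotropic rate**: as `spaceLeibniz3_le` with the tangency slot `τ_t`,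
`0 ≤ τ_t ≤ t·b_τ`, `0 ≤ b_τ`: `Q₃ ≤ A₀·t³·q₃ᵛ/Λ³` with `q₃ᵛ = q₃[√2K₁ ↦ b_τ]`. [folklore] -/
theorem tangentLeibniz3_le {c₀ c C₁ C₂ C₃ K₂ K₃ Λ e₀ t τt bτ a₁ a₂ a₃ ab₁ ab₂ ab₃ : ℝ} (hc₀ : 0 ≤ c₀) (hc : 0 ≤ c) (hC₁ : 0 ≤ C₁)
    (hC₂ : 0 ≤ C₂) (hC₃ : 0 ≤ C₃) (hK₂ : 0 ≤ K₂) (hK₃ : 0 ≤ K₃) (hΛ : 0 < Λ) (hΛe : Λ ≤ e₀) (ht0 : 0 ≤ t) (ht1 : t ≤ 1)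
    (hτt0 : 0 ≤ τt) (hbτ : 0 ≤ bτ) (hτt : τt ≤ t * bτ)
    (hab₁ : 0 ≤ ab₁) (hab₂ : 0 ≤ ab₂) (ha₁ : a₁ ≤ t * ab₁ / Λ) (ha₂ : a₂ ≤ t ^ 2 * ab₂ / Λ ^ 2) (ha₃ : a₃ ≤ t ^ 3 * ab₃ / Λ ^ 3) :
    c₀ * (1 * (C₃ * c / Λ ^ 4 * (τt + 6 * (K₂ * (Real.sqrt 2 * t) ^ 2)) ^ 3 +
          3 * (C₂ * c / Λ ^ 3 * (τt + 6 * (K₂ * (Real.sqrt 2 * t) ^ 2)) * (K₂ * (Real.sqrt 2 * t) ^ 2)) +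
          C₁ * c / Λ ^ 2 * (K₃ * (Real.sqrt 2 * t) ^ 3)) +
        3 * (a₁ * (C₂ * c / Λ ^ 3 * (τt + 5 * (K₂ * (Real.sqrt 2 * t) ^ 2)) ^ 2 + C₁ * c / Λ ^ 2 * (K₂ * (Real.sqrt 2 * t) ^ 2))) +
        3 * (a₂ * (C₁ * c / Λ ^ 2 * (τt + 4 * (K₂ * (Real.sqrt 2 * t) ^ 2)))) + a₃ * (4 * c / Λ)) ≤
      c₀ * (4 * c / Λ) * (t ^ 3 * (C₃ * (bτ + 12 * K₂) ^ 3 / 4 + 3 / 2 * C₂ * K₂ * (bτ + 12 * K₂) * e₀ +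
        Real.sqrt 2 / 2 * C₁ * K₃ * e₀ ^ 2 + 3 * ab₁ * (C₂ * (bτ + 10 * K₂) ^ 2 / 4 + C₁ * K₂ * e₀ / 2) +
        3 / 4 * ab₂ * C₁ * (bτ + 8 * K₂) + ab₃) / Λ ^ 3) := by
  have hs2 : Real.sqrt 2 ^ 2 = 2 := Real.sq_sqrt (by norm_num)
  have hs3 : Real.sqrt 2 ^ 3 = 2 * Real.sqrt 2 := by rw [pow_succ, hs2]
  have hs0 : 0 ≤ Real.sqrt 2 := Real.sqrt_nonneg 2
  have he₀ : 0 < e₀ := lt_of_lt_of_le hΛ hΛe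
  have ht2 : t ^ 2 ≤ t := by nlinarith
  have hst : (Real.sqrt 2 * t) ^ 2 = 2 * t ^ 2 := by rw [mul_pow, hs2]
  have hst3 : (Real.sqrt 2 * t) ^ 3 = 2 * Real.sqrt 2 * t ^ 3 := by rw [mul_pow, hs3]
  have hX : ∀ k : ℝ, 0 ≤ k → τt + k * (K₂ * (Real.sqrt 2 * t) ^ 2) ≤ t * (bτ + 2 * k * K₂) := by
    intro k hk
    rw [hst]
    have e : t * (bτ + 2 * k * K₂) = t * bτ + 2 * k * (K₂ * t) := by ring
    rw [e]
    have := mul_le_mul_of_nonneg_left ht2 (by positivity : 0 ≤ 2 * k * K₂)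
    nlinarith [this]
  have hX0 : ∀ k : ℝ, 0 ≤ k → 0 ≤ τt + k * (K₂ * (Real.sqrt 2 * t) ^ 2) := fun k hk => by positivity
  have h6 := hX 6 (by norm_num); have h60 := hX0 6 (by norm_num)
  have h5 := hX 5 (by norm_num); have h50 := hX0 5 (by norm_num)
  have h4 := hX 4 (by norm_num); have h40 := hX0 4 (by norm_num)
  have hY : K₂ * (Real.sqrt 2 * t) ^ 2 = 2 * K₂ * t ^ 2 := by rw [hst]; ring
  have hΛ2 := pow_pos hΛ 2; have hΛ3 := pow_pos hΛ 3; have hΛ4 := pow_pos hΛ 4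
  have TA : C₃ * c / Λ ^ 4 * (τt + 6 * (K₂ * (Real.sqrt 2 * t) ^ 2)) ^ 3 ≤ (4 * c / Λ) * (t ^ 3 / Λ ^ 3) * (C₃ * (bτ + 12 * K₂) ^ 3 / 4) := by
    have h := pow_le_pow_left₀ h60 h6 3
    have e6 : (2 : ℝ) * 6 = 12 := by norm_num
    rw [e6] at h
    calc C₃ * c / Λ ^ 4 * (τt + 6 * (K₂ * (Real.sqrt 2 * t) ^ 2)) ^ 3
        ≤ C₃ * c / Λ ^ 4 * (t * (bτ + 12 * K₂)) ^ 3 := mul_le_mul_of_nonneg_left h (by positivity)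
      _ = (4 * c / Λ) * (t ^ 3 / Λ ^ 3) * (C₃ * (bτ + 12 * K₂) ^ 3 / 4) := by field_simp
  have TB : 3 * (C₂ * c / Λ ^ 3 * (τt + 6 * (K₂ * (Real.sqrt 2 * t) ^ 2)) * (K₂ * (Real.sqrt 2 * t) ^ 2)) ≤
      (4 * c / Λ) * (t ^ 3 / Λ ^ 3) * (3 / 2 * C₂ * K₂ * (bτ + 12 * K₂) * e₀) := by
    have e6 : (2 : ℝ) * 6 = 12 := by norm_num
    rw [e6] at h6
    calc 3 * (C₂ * c / Λ ^ 3 * (τt + 6 * (K₂ * (Real.sqrt 2 * t) ^ 2)) * (K₂ * (Real.sqrt 2 * t) ^ 2))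
        ≤ 3 * (C₂ * c / Λ ^ 3 * (t * (bτ + 12 * K₂)) * (K₂ * (Real.sqrt 2 * t) ^ 2)) := by
          have := mul_le_mul_of_nonneg_left h6 (by positivity : 0 ≤ C₂ * c / Λ ^ 3)
          have := mul_le_mul_of_nonneg_right this (by positivity : 0 ≤ K₂ * (Real.sqrt 2 * t) ^ 2)
          linarith
      _ = (4 * c / Λ) * (t ^ 3 / Λ ^ 3) * (3 / 2 * C₂ * K₂ * (bτ + 12 * K₂) * Λ) := by rw [hY]; field_simp; ring
      _ ≤ (4 * c / Λ) * (t ^ 3 / Λ ^ 3) * (3 / 2 * C₂ * K₂ * (bτ + 12 * K₂) * e₀) := by gcongr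
  have TC : C₁ * c / Λ ^ 2 * (K₃ * (Real.sqrt 2 * t) ^ 3) ≤ (4 * c / Λ) * (t ^ 3 / Λ ^ 3) * (Real.sqrt 2 / 2 * C₁ * K₃ * e₀ ^ 2) := by
    rw [hst3]
    have hΛe2 : Λ ^ 2 ≤ e₀ ^ 2 := pow_le_pow_left₀ hΛ.le hΛe 2
    calc C₁ * c / Λ ^ 2 * (K₃ * (2 * Real.sqrt 2 * t ^ 3)) = (4 * c / Λ) * (t ^ 3 / Λ ^ 3) * (Real.sqrt 2 / 2 * C₁ * K₃ * Λ ^ 2) := by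
          field_simp; ring
      _ ≤ (4 * c / Λ) * (t ^ 3 / Λ ^ 3) * (Real.sqrt 2 / 2 * C₁ * K₃ * e₀ ^ 2) := by gcongr
  have TD : 3 * (a₁ * (C₂ * c / Λ ^ 3 * (τt + 5 * (K₂ * (Real.sqrt 2 * t) ^ 2)) ^ 2 + C₁ * c / Λ ^ 2 * (K₂ * (Real.sqrt 2 * t) ^ 2))) ≤
      (4 * c / Λ) * (t ^ 3 / Λ ^ 3) * (3 * ab₁ * (C₂ * (bτ + 10 * K₂) ^ 2 / 4 + C₁ * K₂ * e₀ / 2)) := by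
    have e5 : (2 : ℝ) * 5 = 10 := by norm_num
    rw [e5] at h5
    have hbr0 : 0 ≤ C₂ * c / Λ ^ 3 * (τt + 5 * (K₂ * (Real.sqrt 2 * t) ^ 2)) ^ 2 + C₁ * c / Λ ^ 2 * (K₂ * (Real.sqrt 2 * t) ^ 2) := by
      positivity
    have hbr : C₂ * c / Λ ^ 3 * (τt + 5 * (K₂ * (Real.sqrt 2 * t) ^ 2)) ^ 2 + C₁ * c / Λ ^ 2 * (K₂ * (Real.sqrt 2 * t) ^ 2) ≤
        t ^ 2 * (C₂ * c * (bτ + 10 * K₂) ^ 2 / Λ ^ 3 + 2 * C₁ * c * K₂ / Λ ^ 2) := by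
      have hsq := pow_le_pow_left₀ h50 h5 2
      have t1 := mul_le_mul_of_nonneg_left hsq (by positivity : 0 ≤ C₂ * c / Λ ^ 3)
      have e : t ^ 2 * (C₂ * c * (bτ + 10 * K₂) ^ 2 / Λ ^ 3 + 2 * C₁ * c * K₂ / Λ ^ 2) =
          C₂ * c / Λ ^ 3 * (t * (bτ + 10 * K₂)) ^ 2 + C₁ * c / Λ ^ 2 * (K₂ * (Real.sqrt 2 * t) ^ 2) := by rw [hY]; ring
      rw [e]; linarith
    calc 3 * (a₁ * (C₂ * c / Λ ^ 3 * (τt + 5 * (K₂ * (Real.sqrt 2 * t) ^ 2)) ^ 2 + C₁ * c / Λ ^ 2 * (K₂ * (Real.sqrt 2 * t) ^ 2)))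
        ≤ 3 * ((t * ab₁ / Λ) * (t ^ 2 * (C₂ * c * (bτ + 10 * K₂) ^ 2 / Λ ^ 3 + 2 * C₁ * c * K₂ / Λ ^ 2))) := by
          have := mul_le_mul ha₁ hbr hbr0 (by positivity)
          linarith
      _ = (4 * c / Λ) * (t ^ 3 / Λ ^ 3) * (3 * ab₁ * (C₂ * (bτ + 10 * K₂) ^ 2 / 4 + C₁ * K₂ * Λ / 2)) := by field_simp; ring
      _ ≤ (4 * c / Λ) * (t ^ 3 / Λ ^ 3) * (3 * ab₁ * (C₂ * (bτ + 10 * K₂) ^ 2 / 4 + C₁ * K₂ * e₀ / 2)) := by gcongr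
  have TE : 3 * (a₂ * (C₁ * c / Λ ^ 2 * (τt + 4 * (K₂ * (Real.sqrt 2 * t) ^ 2)))) ≤
      (4 * c / Λ) * (t ^ 3 / Λ ^ 3) * (3 / 4 * ab₂ * C₁ * (bτ + 8 * K₂)) := by
    have e4 : (2 : ℝ) * 4 = 8 := by norm_num
    rw [e4] at h4
    have hbr0 : 0 ≤ C₁ * c / Λ ^ 2 * (τt + 4 * (K₂ * (Real.sqrt 2 * t) ^ 2)) := by positivity
    have hbr : C₁ * c / Λ ^ 2 * (τt + 4 * (K₂ * (Real.sqrt 2 * t) ^ 2)) ≤ C₁ * c / Λ ^ 2 * (t * (bτ + 8 * K₂)) :=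
      mul_le_mul_of_nonneg_left h4 (by positivity)
    calc 3 * (a₂ * (C₁ * c / Λ ^ 2 * (τt + 4 * (K₂ * (Real.sqrt 2 * t) ^ 2))))
        ≤ 3 * ((t ^ 2 * ab₂ / Λ ^ 2) * (C₁ * c / Λ ^ 2 * (t * (bτ + 8 * K₂)))) := by
          have := mul_le_mul ha₂ hbr hbr0 (by positivity)
          linarith
      _ = (4 * c / Λ) * (t ^ 3 / Λ ^ 3) * (3 / 4 * ab₂ * C₁ * (bτ + 8 * K₂)) := by field_simp
  have TF : a₃ * (4 * c / Λ) ≤ (4 * c / Λ) * (t ^ 3 / Λ ^ 3) * ab₃ := by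
    calc a₃ * (4 * c / Λ) ≤ (t ^ 3 * ab₃ / Λ ^ 3) * (4 * c / Λ) := mul_le_mul_of_nonneg_right ha₃ (by positivity)
      _ = (4 * c / Λ) * (t ^ 3 / Λ ^ 3) * ab₃ := by field_simp
  have e : c₀ * (4 * c / Λ) * (t ^ 3 * (C₃ * (bτ + 12 * K₂) ^ 3 / 4 + 3 / 2 * C₂ * K₂ * (bτ + 12 * K₂) * e₀ +
        Real.sqrt 2 / 2 * C₁ * K₃ * e₀ ^ 2 + 3 * ab₁ * (C₂ * (bτ + 10 * K₂) ^ 2 / 4 + C₁ * K₂ * e₀ / 2) +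
        3 / 4 * ab₂ * C₁ * (bτ + 8 * K₂) + ab₃) / Λ ^ 3) =
      c₀ * ((4 * c / Λ) * (t ^ 3 / Λ ^ 3) * (C₃ * (bτ + 12 * K₂) ^ 3 / 4) +
        (4 * c / Λ) * (t ^ 3 / Λ ^ 3) * (3 / 2 * C₂ * K₂ * (bτ + 12 * K₂) * e₀) +
        (4 * c / Λ) * (t ^ 3 / Λ ^ 3) * (Real.sqrt 2 / 2 * C₁ * K₃ * e₀ ^ 2) +
        (4 * c / Λ) * (t ^ 3 / Λ ^ 3) * (3 * ab₁ * (C₂ * (bτ + 10 * K₂) ^ 2 / 4 + C₁ * K₂ * e₀ / 2)) +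
        (4 * c / Λ) * (t ^ 3 / Λ ^ 3) * (3 / 4 * ab₂ * C₁ * (bτ + 8 * K₂)) +
        (4 * c / Λ) * (t ^ 3 / Λ ^ 3) * ab₃) := by ring
  rw [e]
  refine mul_le_mul_of_nonneg_left ?_ hc₀
  linarith [TA, TB, TC, TD, TE, TF]

/-- **The tangency datum is `O(ℓ)`**: `τ_t = ℓ₁(4+2A) + K₂(√2ρ_f)(√2ℓ) ≤ ℓ·((4+2A) + 2K₂c_ρπ)` for `0 ≤ ℓ₁ ≤ ℓ`, `0 ≤ ρ_f ≤ c_ρπ`, `K₂, A ≥ 0`.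
[folklore] -/
theorem tauT_le_step {A K₂ ρf ℓ ℓ₁ cρ : ℝ} (hA : 0 ≤ A) (hK₂ : 0 ≤ K₂) (hℓ₁ : 0 ≤ ℓ₁) (hℓ₁ℓ : ℓ₁ ≤ ℓ) (hρf : ρf ≤ cρ * Real.pi) :
    ℓ₁ * (4 + 2 * A) + K₂ * (Real.sqrt 2 * ρf) * (Real.sqrt 2 * ℓ) ≤ ℓ * ((4 + 2 * A) + 2 * K₂ * (cρ * Real.pi)) := by
  have hs2 : Real.sqrt 2 * Real.sqrt 2 = 2 := Real.mul_self_sqrt (by norm_num)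
  have hℓ : 0 ≤ ℓ := hℓ₁.trans hℓ₁ℓ
  have e : K₂ * (Real.sqrt 2 * ρf) * (Real.sqrt 2 * ℓ) = 2 * K₂ * ρf * ℓ := by
    calc K₂ * (Real.sqrt 2 * ρf) * (Real.sqrt 2 * ℓ) = (Real.sqrt 2 * Real.sqrt 2) * K₂ * ρf * ℓ := by ring
      _ = 2 * K₂ * ρf * ℓ := by rw [hs2]
  rw [e]
  have h1 : ℓ₁ * (4 + 2 * A) ≤ ℓ * (4 + 2 * A) := mul_le_mul_of_nonneg_right hℓ₁ℓ (by positivity)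
  have h2 : 2 * K₂ * ρf * ℓ ≤ 2 * K₂ * (cρ * Real.pi) * ℓ :=
    mul_le_mul_of_nonneg_right (mul_le_mul_of_nonneg_left hρf (by positivity)) hℓ
  nlinarith [h1, h2]

end Summit.HubbardSuperconductivity.HubbardSuperconductivity.Theorems.TorusFourierL2

end
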